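import Summits.Ventures.HSemireg.Pad4TowerPsiSubA1

/-!
# Venture HSemireg — PAD-4: the Δ-WINDOW class algebra in the kernel (IDEATOR LINE 2 §1; gs-eng-2 g51 RESULT 4 (3)) —
# Δ = (i,i,i,i) twists the class tensor word by word by `i^{n_e − n_ē}`; the class screen (A1) is Δ-stable; on a Δ-closed support
# Δ-averaging is WLOG (screen kept, μ quadrupled, multiplicities stay ≥ 1); a Δ-invariant design has every word with
# `n_e − n_ē ≢ 0 (mod 4)` vanish identically — 840 of the 1 038 e-mixed rows

HONEST FRAMING. Lean index of the computation cell `pub-hsemireg` (S4-PUSH, H2 door PAD-4), typed by the Ventures-side typer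
`hodge-lit-semireg-typer-2` (g4; line of record stmt-HodgeConjecture-18881 `Cruxes/BlochSeedDiscOne/Lines/birth.lean` 814a6a70c14e831a,
stub `stub_rung_pad4_seedAt`, screen (H1); card v4.10 row W14 = leg (α) W-SEARCH-Δ, «the ONE remaining search leg», director-hodge g11
RULING W1-Δ l.31728 ∕ g12 R12.2). Fourth file of the KERNEL LEMMA Ψ ⊂ (A1) set (`Pad4TowerClassScreen` — frame, screen, Λ;
`Pad4TowerPsiSubA1` — 𝔅(μ₄) cells `MCell.ch`, weighted tensors `MConfig.wch`, FILE A seam; `Pad4TowerEFreeAnnihilators` — RESULT 5).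
THIS FILE types the CLASS-ALGEBRA HALF (§1) of bc5-plan g6's IDEATOR LINE 2 (cell INBOX l.31727, 2026-08-27T23:2xZ; card W14): «Δ :=
(i,i,i,i) = the diagonal CM rotation ρ₁ρ₂ρ₃ρ₄ of S⁴ (β_f ↦ iβ_f on every factor; O, bare nodes, u, v, p fixed; e_f ↦ i·e_f) … a
Δ-INVARIANT design (WLOG on any Δ-closed support by Δ-averaging: the (A1)∕(H1) system and ℚ[h] ⊕ W are Δ-stable) keeps μ free
(Δ·eeee = eeee) and has every (A1)-word with n_e − n_ē ≢ 0 (mod 4) ZERO IDENTICALLY: 840 of the 1 038 mixed rows vanish for free, 198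
Hermitian rows ((e,ē,x,y): 192; (e,e,ē,ē): 6) + the 247 e-free d-rows (phase-blind) + Ψ remain», and gs-eng-2 g51 RESULT 4 (3)
(l.31731): «a Δ-closed support carries an (H1) solution iff it carries a Δ-invariant one, by averaging — the rows and ℚ[h] ⊕ W are
Δ-stable, μ is Δ-fixed» (the premise of the W-SEARCH-Δ post-filter deciding (H1) on the Δ-AVERAGED design).

CONTENT (all PROVED; no `sorry`; axioms standard).
* §1 `deltaPt` (`(α, Re β, Im β) ↦ (α, −Im β, Re β)` = `β ↦ iβ`; named apart from `Pad4TowerAlphabetMu4.rotPt x j`), **`MCell.delta`** (Δ on cells), `deltaPt_four`, `MCell.delta_four` (`Δ⁴ = 1`),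
  `MCell.delta_injective`; `gI = i`, `twExp` (`e ↦ 1`, `ē ↦ 3`, real letters `↦ 0`), `wtwExp`, **`twistW w = i^{Σ twExp} = i^{n_e − n_ē}`**;
  `bphi_deltaPt` (Δ multiplies the `e`-entry by `i`, the `ē`-entry by `−i`, fixes `1, α, α, p`); **`MCell.ch_delta`: `ch(ΔZ)(w) =
  twistW(w) · ch(Z)(w)`**; `twistW_eq_one_of_eFree`; `twistW_eWord` (`Δ·eeee = eeee`: μ is Δ-fixed).
* §2 **`classScreen_twist`** (twisting by any power of the twist preserves the class screen — «(A1) is Δ-stable»), `classScreen_add`.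
* §3 `DeltaClosed S`, `image_delta_eq`, **`sum_delta_reindex`** (Δ permutes a Δ-closed finite set), `DeltaClosed.iter`;
  **`MConfig.wch_comp_delta`** (weights transported by Δ ⇒ tensor twisted by the cube of the twist), `wch_comp_delta2∕3`;
  **`MConfig.wch_eq_zero_of_deltaInvariant`: a Δ-invariant weighted design on a Δ-closed support has `wch(w) = 0` at every word with
  `twistW w ≠ 1`** (for EVERY design — no (A1) needed); `twistW_eq_one_iff` (`twistW w = 1 ⟺ 4 ∣ n_e + 3n_ē`); **`mixed_twisted_count`**
  (`decide`): 1 038 e-mixed words other than `eeee`, `ēēēē`, of which exactly 840 are twisted (198 not).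
* §4 `deltaAvg m = m + m∘Δ + m∘Δ² + m∘Δ³`, `deltaAvg_delta` (Δ-invariant), `deltaAvg_pos`, `MConfig.wch_deltaAvg`;
  **`MConfig.classScreen_deltaAvg`** ((A1) survives averaging), **`MConfig.wch_deltaAvg_eWord`** (`eeee`-coefficient `× 4`);
  **`MConfig.deltaInvariant_wlog`**: on a Δ-closed support a vector `m ≥ 1` with (A1) and `μ ≠ 0` yields the Δ-INVARIANT `deltaAvg m ≥ 1`
  with (A1) and `μ ≠ 0` — RESULT 4 (3)'s «WLOG by averaging», kernel form.
* §5 probe (`decide`): Δ on the letters of `Pad4TowerCrossPhase` (`lpt 1 k ↦ lpt 1 (k−1)`: `ℓ_{i^k} ↦ ℓ_{i^{k−1}}`, i.e. `β = ζ̄ ↦ iζ̄`),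
  `O` and `2I` fixed, the four-phase FC cell has a genuine 4-orbit.

PRECISION (hostile read s4-ref g85, cell INBOX l.31881, P1): `wch_eq_zero_of_deltaInvariant` needs Δ-INVARIANT multiplicities (and a
Δ-closed support): the 840 twisted rows may be dropped ONLY on the Δ-AVERAGED design — `deltaInvariant_wlog` is the licence to pass to it
(same support, (A1) and μ ≠ 0 preserved); on a general weighted design over a Δ-closed support those rows do NOT vanish.

WHAT IS NOT HERE ∕ NOT IN LEAN. §2–§3 of IDEATOR LINE 2 (the E10 ∕ X∞ non-coverage claim, `PSCMu4` on Δ-invariant supports, the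
instance sizes) and FC-CORE-Δ (RESULT 4 (1)–(2): parity-pattern bookkeeping; kernel FC-CORE is `Pad4FCCore` ∕ `Pad4FCCoreParity`); the
«only if» direction of the WLOG is the trivial one (a Δ-invariant solution is a solution) and is not restated; the count «247 e-free d-rows»
is w1h1's row bookkeeping, not retyped. That the frame IS `H^{ev}(S⁴)` and that Δ IS the CM automorphism's action on it are the cell's
pencil modelling sentences (LINE 2 §1; PAD4-THEOREM-L (6.6)). No variety, sheaf, σ, seed or abelian variety; NOTHING HERE SAYS THAT HC ∕
HC_CM ∕ HC_AV ∕ W₆ ∕ HC_Kum4Type HOLDS OR FAILS. No `instance`, no notation, no named fact, 0 `sorry`.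

SOURCES (sha16): bc5-plan g6 IDEATOR LINE 2 cell INBOX l.31727 and card v4.10 440016c9592a702a row W14; gs-eng-2 g51 RESULT 4 l.31731 (3);
director-hodge g11 RULING W1-Δ l.31728; w1h1.py 822105c02c0c27a3 (`MIXED`: 1 038 words); tree∕staged `Pad4TowerClassScreen.lean`
1ffb82cfe6f0a1dc (p591160), `Pad4TowerPsiSubA1.lean` 8a8ffcebf99475df, `Pad4TowerCrossPhase.lean` 8f09792281b0723a (`lpt`, `mcellOf`).
-/

namespace Summit.Ventures.HSemireg.Pad4Tower

open Finset Summit.Ventures.HSemireg.Pad4FirstOrder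

/-! ## §1 Δ on factor points and cells; the twist of the letter vector -/

/-- the CM rotation on ONE factor point: `β ↦ i·β`, `α` fixed — `(α, Re β, Im β) ↦ (α, −Im β, Re β)`. -/
def deltaPt (x : BPoint) : BPoint := (x.1, -x.2.2, x.2.1)

/-- **Δ = (i, i, i, i)**: the diagonal CM rotation, `β_f ↦ i β_f` on every factor (IDEATOR LINE 2: «O, bare nodes, u, v, p fixed;
e_f ↦ i·e_f»). -/
def MCell.delta (Z : MCell) : MCell := fun f => deltaPt (Z f)

/-- `Δ⁴ = 1` on factor points. -/
theorem deltaPt_four (x : BPoint) : deltaPt (deltaPt (deltaPt (deltaPt x))) = x := by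
  simp [deltaPt]

/-- `Δ⁴ = 1` on cells. -/
theorem MCell.delta_four (Z : MCell) : Z.delta.delta.delta.delta = Z := by
  funext f
  simp [MCell.delta, deltaPt_four]

/-- Δ is injective on cells. -/
theorem MCell.delta_injective : Function.Injective MCell.delta := fun Z Z' h => by
  rw [← Z.delta_four, ← Z'.delta_four, h]

/-- the Gaussian unit `i`. -/
def gI : GaussianInt := ⟨0, 1⟩

/-- the TWIST EXPONENT of a letter: `e ↦ 1`, `ē ↦ 3` (`−i = i³`), the four real letters `↦ 0`. -/
def twExp : Fin 6 → ℕ := ![0, 0, 0, 1, 3, 0]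

/-- the twist exponent of a word: `Σ_f twExp(w_f) ≡ n_e − n_ē (mod 4)`. -/
def wtwExp (w : CWord) : ℕ := twExp (w 0) + twExp (w 1) + twExp (w 2) + twExp (w 3)

/-- the twist of a word: `i^{wtwExp w} = i^{n_e − n_ē}`. -/
def twistW (w : CWord) : GaussianInt := gI ^ wtwExp w

/-- Δ multiplies each letter entry by `i^{twExp}`: `(1, α, α, iβ, −iβ̄, p)`. -/
theorem bphi_deltaPt (x : BPoint) (l : Fin 6) : bphi (deltaPt x) l = gI ^ twExp l * bphi x l := by
  fin_cases l
  · simp [bphi, deltaPt, phiVec, twExp]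
  · simp [bphi, deltaPt, phiVec, twExp]
  · simp [bphi, deltaPt, phiVec, twExp]
  · simp only [bphi, deltaPt, phiVec, twExp, gI]
    simp [Zsqrtd.ext_iff]
  · simp only [bphi, deltaPt, phiVec, twExp, gI]
    simp [Zsqrtd.ext_iff, pow_succ]
  · simp only [bphi, deltaPt, phiVec, twExp]
    simp
    ring

/-- **Δ TWISTS THE CLASS TENSOR**: `ch(ΔZ)(w) = i^{n_e(w) − n_ē(w)} · ch(Z)(w)`. -/
theorem MCell.ch_delta (Z : MCell) (w : CWord) : Z.delta.ch w = twistW w * Z.ch w := by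
  simp only [MCell.ch, chTensor, MCell.delta, bphi_deltaPt, twistW, wtwExp, pow_add]
  ring

/-- e-free words are not twisted. -/
theorem twistW_eq_one_of_eFree (w : CWord) (hw : EFree w) : twistW w = 1 := by
  have h : ∀ f, twExp (w f) = 0 := fun f => by
    obtain ⟨h3, h4⟩ := hw f
    generalize w f = l at h3 h4
    fin_cases l <;> simp_all [twExp]
  simp [twistW, wtwExp, h]

/-- `eeee` is not twisted (`i⁴ = 1`): Δ FIXES THE μ-WORD («Δ·eeee = eeee», «μ is Δ-fixed»). [`decide`] -/
theorem twistW_eWord : twistW eWord = 1 ∧ twistW ebarWord = 1 := by decide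

/-! ## §2 The class screen is Δ-stable; twisting and summing preserve it -/

/-- **(A1) IS Δ-STABLE**: twisting a class function word by word by any power of the twist preserves the class screen (mixed words
stay `0`, e-free words are untouched). -/
theorem classScreen_twist (T : CWord → GaussianInt) (k : ℕ) (h : ClassScreen T) :
    ClassScreen fun w => twistW w ^ k * T w := by
  obtain ⟨h0, hd⟩ := h
  refine ⟨fun w hw h1 h2 => by simp [h0 w hw h1 h2], fun w w' hw hw' hdeg => ?_⟩
  simp [twistW_eq_one_of_eFree w hw, twistW_eq_one_of_eFree w' hw', hd w w' hw hw' hdeg]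

/-- the class screen is closed under addition. -/
theorem classScreen_add {T T' : CWord → GaussianInt} (h : ClassScreen T) (h' : ClassScreen T') : ClassScreen (T + T') :=
  ⟨fun w hw h1 h2 => by simp [h.1 w hw h1 h2, h'.1 w hw h1 h2],
    fun w w' hw hw' hd => by simp [h.2 w w' hw hw' hd, h'.2 w w' hw hw' hd]⟩

/-! ## §3 Δ-closed supports: reindexing, the twist of the weighted tensor, averaging -/

/-- a finite set of cells is Δ-CLOSED. -/
abbrev DeltaClosed (S : Finset MCell) : Prop := ∀ Z ∈ S, Z.delta ∈ S

/-- on a Δ-closed finite set Δ is a permutation: its image is the whole set. -/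
theorem image_delta_eq (S : Finset MCell) (hS : DeltaClosed S) : S.image MCell.delta = S := by
  apply Finset.eq_of_subset_of_card_le
  · intro x hx
    obtain ⟨Z, hZ, rfl⟩ := Finset.mem_image.1 hx
    exact hS Z hZ
  · rw [Finset.card_image_of_injective _ MCell.delta_injective]

/-- REINDEXING by Δ on a Δ-closed set: `Σ_{Z ∈ S} g(ΔZ) = Σ_{Z ∈ S} g(Z)`. -/
theorem sum_delta_reindex {M : Type*} [AddCommMonoid M] (S : Finset MCell) (hS : DeltaClosed S) (g : MCell → M) :
    ∑ Z ∈ S, g Z.delta = ∑ Z ∈ S, g Z := by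
  conv_rhs => rw [← image_delta_eq S hS]
  rw [Finset.sum_image fun Z _ Z' _ h => MCell.delta_injective h]

/-- a Δ-closed set is closed under `Δ²` and `Δ³` as well. -/
theorem DeltaClosed.iter {S : Finset MCell} (hS : DeltaClosed S) (Z : MCell) (hZ : Z ∈ S) :
    Z.delta.delta ∈ S ∧ Z.delta.delta.delta ∈ S :=
  ⟨hS _ (hS Z hZ), hS _ (hS _ (hS Z hZ))⟩

/-- the weighted class tensor with weights TRANSPORTED by Δ (`m ∘ Δ`) is the cube-twisted tensor:
`Σ m(ΔZ)·ch(Z) = (i^{n_e−n_ē})³ · Σ m(Z)·ch(Z)` on a Δ-closed support (substitute `Z = Δ³x`). -/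
theorem MConfig.wch_comp_delta (C : MConfig) (hl : DeltaClosed C.lower) (hu : DeltaClosed C.upper) (mN mP : MCell → ℤ)
    (w : CWord) : C.wch (fun Z => mN Z.delta) (fun P => mP P.delta) w = twistW w ^ 3 * C.wch mN mP w := by
  have key : ∀ (S : Finset MCell), DeltaClosed S → ∀ m : MCell → ℤ,
      (∑ Z ∈ S, m Z.delta • Z.ch) w = twistW w ^ 3 * (∑ Z ∈ S, m Z • Z.ch) w := by
    intro S hS m
    have r := sum_delta_reindex S hS (fun Z => m Z • Z.delta.delta.delta.ch)
    simp only [MCell.delta_four] at r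
    rw [r]
    simp only [Finset.sum_apply, Pi.smul_apply]
    simp only [zsmul_eq_mul, MCell.ch_delta, Finset.mul_sum]
    exact Finset.sum_congr rfl fun Z _ => by ring
  simp only [MConfig.wch, Pi.sub_apply, key C.lower hl mN, key C.upper hu mP]
  ring

/-- **A Δ-INVARIANT DESIGN HAS EVERY TWISTED WORD VANISH** (IDEATOR LINE 2 §1: «a Δ-invariant design … has every (A1)-word with
`n_e − n_ē ≢ 0 (mod 4)` ZERO IDENTICALLY»): on a Δ-closed support with Δ-invariant multiplicities, `wch(w) = i^{n_e−n_ē}·wch(w)`, so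
`wch(w) = 0` whenever the twist `i^{n_e − n_ē} ≠ 1` — for EVERY weighted design, (A1) or not. -/
theorem MConfig.wch_eq_zero_of_deltaInvariant (C : MConfig) (hl : DeltaClosed C.lower) (hu : DeltaClosed C.upper)
    (mN mP : MCell → ℤ) (hN : ∀ Z, mN Z.delta = mN Z) (hP : ∀ P, mP P.delta = mP P) (w : CWord) (hw : twistW w ≠ 1) :
    C.wch mN mP w = 0 := by
  have h := C.wch_comp_delta hl hu mN mP w
  simp only [hN, hP] at h
  have h3 : twistW w ^ 3 * twistW w = 1 := by
    rw [← pow_succ, twistW, ← pow_mul, show gI ^ (wtwExp w * 4) = (gI ^ 4) ^ wtwExp w by rw [mul_comm, pow_mul]]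
    have : gI ^ 4 = 1 := by decide
    rw [this, one_pow]
  have h1 : (twistW w ^ 3 - 1) * C.wch mN mP w = 0 := by linear_combination (-1 : GaussianInt) * h
  rcases mul_eq_zero.1 h1 with h2 | h2
  · exfalso
    apply hw
    linear_combination (-(twistW w)) * h2 + h3
  · exact h2

/-- the 1 038 e-mixed words other than `eeee`, `ēēēē` (w1h1 `MIXED`), of which exactly 840 are twisted (`i^{n_e − n_ē} ≠ 1`) and 198 are not
(«840 of the 1 038 mixed rows vanish for free, 198 Hermitian rows … remain»). [kernel, `decide`] -/
theorem mixed_twisted_count :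
    (univ.filter fun w : CWord => ¬ EFree w ∧ w ≠ eWord ∧ w ≠ ebarWord).card = 1038 ∧
    (univ.filter fun w : CWord => ¬ EFree w ∧ w ≠ eWord ∧ w ≠ ebarWord ∧ wtwExp w % 4 ≠ 0).card = 840 := by
  decide +kernel

/-- the twist is `1` exactly when `4 ∣ n_e + 3 n_ē`, i.e. `n_e ≡ n_ē (mod 4)`. -/
theorem twistW_eq_one_iff (w : CWord) : twistW w = 1 ↔ wtwExp w % 4 = 0 := by
  have h4 : gI ^ 4 = 1 := by decide
  have key : gI ^ wtwExp w = gI ^ (wtwExp w % 4) := by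
    conv_lhs => rw [← Nat.mod_add_div (wtwExp w) 4, pow_add, pow_mul, h4, one_pow, mul_one]
  rw [twistW, key]
  have h := Nat.mod_lt (wtwExp w) (by norm_num : 0 < 4)
  generalize wtwExp w % 4 = r at h ⊢
  interval_cases r <;> decide

/-! ## §4 Δ-averaging is WLOG (gs-eng-2 g51 RESULT 4 (3): «a Δ-closed support carries an (H1) solution iff it carries a Δ-invariant
one, by averaging — the rows and ℚ[h] ⊕ W are Δ-stable, μ is Δ-fixed») -/

/-- the Δ-AVERAGE (×4) of a multiplicity function: `m(Z) + m(ΔZ) + m(Δ²Z) + m(Δ³Z)`. -/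
def deltaAvg (m : MCell → ℤ) (Z : MCell) : ℤ := m Z + m Z.delta + m Z.delta.delta + m Z.delta.delta.delta

/-- the Δ-average is Δ-invariant. -/
theorem deltaAvg_delta (m : MCell → ℤ) (Z : MCell) : deltaAvg m Z.delta = deltaAvg m Z := by
  simp only [deltaAvg, MCell.delta_four]
  ring

/-- the Δ-average of positive multiplicities on a Δ-closed support is positive there. -/
theorem deltaAvg_pos {S : Finset MCell} (hS : DeltaClosed S) {m : MCell → ℤ} (hm : ∀ Z ∈ S, 0 < m Z) (Z : MCell) (hZ : Z ∈ S) :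
    0 < deltaAvg m Z := by
  have h1 := hm _ (hS Z hZ); have h2 := hm _ (hS.iter Z hZ).1; have h3 := hm _ (hS.iter Z hZ).2; have h0 := hm Z hZ
  unfold deltaAvg; omega

/-- the weighted tensor of the Δ-averaged design is the sum of the four transported ones. -/
theorem MConfig.wch_deltaAvg (C : MConfig) (mN mP : MCell → ℤ) :
    C.wch (deltaAvg mN) (deltaAvg mP) = C.wch mN mP + C.wch (fun Z => mN Z.delta) (fun P => mP P.delta)
      + C.wch (fun Z => mN Z.delta.delta) (fun P => mP P.delta.delta)
      + C.wch (fun Z => mN Z.delta.delta.delta) (fun P => mP P.delta.delta.delta) := by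
  simp only [MConfig.wch, deltaAvg, add_smul, Finset.sum_add_distrib]
  abel

/-- transport by `Δ²` twists by the 6th power. -/
theorem MConfig.wch_comp_delta2 (C : MConfig) (hl : DeltaClosed C.lower) (hu : DeltaClosed C.upper) (mN mP : MCell → ℤ)
    (w : CWord) : C.wch (fun Z => mN Z.delta.delta) (fun P => mP P.delta.delta) w = twistW w ^ 6 * C.wch mN mP w := by
  rw [C.wch_comp_delta hl hu (fun Z => mN Z.delta) (fun P => mP P.delta) w, C.wch_comp_delta hl hu mN mP w]
  ring

/-- transport by `Δ³` twists by the 9th power. -/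
theorem MConfig.wch_comp_delta3 (C : MConfig) (hl : DeltaClosed C.lower) (hu : DeltaClosed C.upper) (mN mP : MCell → ℤ)
    (w : CWord) : C.wch (fun Z => mN Z.delta.delta.delta) (fun P => mP P.delta.delta.delta) w = twistW w ^ 9 * C.wch mN mP w := by
  rw [C.wch_comp_delta hl hu (fun Z => mN Z.delta.delta) (fun P => mP P.delta.delta) w, C.wch_comp_delta2 hl hu mN mP w]
  ring

/-- **Δ-AVERAGING PRESERVES (A1)**: on a Δ-closed support, if the weighted class tensor passes the class screen then so does the
Δ-averaged one. -/
theorem MConfig.classScreen_deltaAvg (C : MConfig) (hl : DeltaClosed C.lower) (hu : DeltaClosed C.upper) (mN mP : MCell → ℤ)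
    (h : ClassScreen (C.wch mN mP)) : ClassScreen (C.wch (deltaAvg mN) (deltaAvg mP)) := by
  have t1 : C.wch (fun Z => mN Z.delta) (fun P => mP P.delta) = fun w => twistW w ^ 3 * C.wch mN mP w :=
    funext fun w => C.wch_comp_delta hl hu mN mP w
  have t2 : C.wch (fun Z => mN Z.delta.delta) (fun P => mP P.delta.delta) = fun w => twistW w ^ 6 * C.wch mN mP w :=
    funext fun w => C.wch_comp_delta2 hl hu mN mP w
  have t3 : C.wch (fun Z => mN Z.delta.delta.delta) (fun P => mP P.delta.delta.delta) =
      fun w => twistW w ^ 9 * C.wch mN mP w :=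
    funext fun w => C.wch_comp_delta3 hl hu mN mP w
  rw [C.wch_deltaAvg, t1, t2, t3]
  exact classScreen_add (classScreen_add (classScreen_add h (classScreen_twist _ 3 h)) (classScreen_twist _ 6 h))
    (classScreen_twist _ 9 h)

/-- **Δ-AVERAGING QUADRUPLES THE μ-WORD** (`Δ·eeee = eeee`): the `eeee`-coefficient of the averaged design is `4×` the original —
so `μ ≠ 0` is preserved. -/
theorem MConfig.wch_deltaAvg_eWord (C : MConfig) (hl : DeltaClosed C.lower) (hu : DeltaClosed C.upper) (mN mP : MCell → ℤ) :
    C.wch (deltaAvg mN) (deltaAvg mP) eWord = 4 * C.wch mN mP eWord := by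
  have e := twistW_eWord.1
  rw [C.wch_deltaAvg]
  simp only [Pi.add_apply]
  rw [C.wch_comp_delta hl hu mN mP, C.wch_comp_delta2 hl hu mN mP, C.wch_comp_delta3 hl hu mN mP, e]
  ring

/-- **Δ-AVERAGING IS WLOG** (RESULT 4 (3), kernel form): on a Δ-closed support, a multiplicity vector `m ≥ 1` satisfying (A1) with
`μ ≠ 0` yields the Δ-INVARIANT vector `deltaAvg m ≥ 1` satisfying (A1) with `μ ≠ 0`. -/
theorem MConfig.deltaInvariant_wlog (C : MConfig) (hl : DeltaClosed C.lower) (hu : DeltaClosed C.upper) (mN mP : MCell → ℤ)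
    (hN : ∀ Z ∈ C.lower, 0 < mN Z) (hP : ∀ P ∈ C.upper, 0 < mP P) (h : ClassScreen (C.wch mN mP))
    (hμ : C.wch mN mP eWord ≠ 0) :
    (∀ Z, deltaAvg mN Z.delta = deltaAvg mN Z) ∧ (∀ P, deltaAvg mP P.delta = deltaAvg mP P) ∧
      (∀ Z ∈ C.lower, 0 < deltaAvg mN Z) ∧ (∀ P ∈ C.upper, 0 < deltaAvg mP P) ∧
      ClassScreen (C.wch (deltaAvg mN) (deltaAvg mP)) ∧ C.wch (deltaAvg mN) (deltaAvg mP) eWord ≠ 0 := by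
  refine ⟨deltaAvg_delta mN, deltaAvg_delta mP, deltaAvg_pos hl hN, deltaAvg_pos hu hP,
    C.classScreen_deltaAvg hl hu mN mP h, ?_⟩
  rw [C.wch_deltaAvg_eWord hl hu]
  exact mul_ne_zero (by decide) hμ

/-! ## §5 Kernel probes -/

/-- Δ on the letters: `ℓ_{i^k} ↦ ℓ_{i^{k−1}}` in `Pad4TowerCrossPhase`'s indexing (`lpt 1 k = (1, conj(i^k))`, `β ↦ iβ`), `O` and `2I`
fixed; and the orbit of the four-phase cell `[ℓ₁|ℓ₋ᵢ|ℓ₋₁|ℓ_i]` closes up after four steps. [kernel, `decide`] -/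
theorem delta_probes :
    deltaPt (lpt 1 0) = lpt 1 3 ∧ deltaPt (lpt 1 3) = lpt 1 2 ∧ deltaPt (lpt 1 2) = lpt 1 1 ∧ deltaPt (lpt 1 1) = lpt 1 0 ∧
    deltaPt (0, 0, 0) = (0, 0, 0) ∧ deltaPt (2, 0, 0) = (2, 0, 0) ∧ fcCell.delta.delta.delta.delta = fcCell ∧ fcCell.delta ≠ fcCell := by
  decide +kernel

end Summit.Ventures.HSemireg.Pad4Tower
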